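import Mathlib.Analysis.SpecialFunctions.Pow.Asymptotics
import Mathlib.Analysis.Calculus.Deriv.Polynomial
import Literature.NumberTheory.Transcendental.ExpVarieties
import Literature.ModelTheory.ExponentialFields.Languages
import Summits.Schanuel.Schanuel.Theorems.ZilberEacComplexMovingPolydisc
import HarnessLib

/-!
# EC over real hyperplane bases (the degree-one end of the oscillatory class)

A case of Zilber's Exponential-Algebraic Closedness in the range `dim π₁(V) = n - 1` (first open
rung, Mantova–Masser, PLMS 129 (2024), §1 p. 5) for `(s+1)`-folds whose additive projection is a
hyperplane `x_{s+1} = Σⱼ rⱼ xⱼ + c` with REAL coefficients `rⱼ` and whose fibres are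
`yⱼ = Aⱼ(x') + y_{s+1} Fⱼ(y_{s+1})`. For real `r` every lattice direction is oscillatory
(`Re(2πi r·q) = 0`), and the base has degree `1`, so neither the negative-leading-part theorems
(`…PunctureDecoupling`, `…PunctureBM`) nor the second-order theorem (`exists_expPoint_of_oscillatory`,
`deg g ≥ 2`) applies; instead, on the unit polydisc around the lattice centre `x₀(m)` one has exactly
`Re x_{s+1} = λ log m + O(1)`, `λ := Σⱼ rⱼ deg Aⱼ`, so for `λ < 0` the coordinate `y_{s+1}` tends to
the puncture polynomially (`|y_{s+1}| ≍ m^{λ}`) — enough for fibres depending on `y_{s+1}` alone, by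
the moving-polydisc perturbation theorem `exists_exp_eq_poly_add_near_latticeCentre`.
(For `V` to be additively free one needs `r ∉ ℚˢ`; the theorem does not use this. Not of the form
`L × W` of Gallinaro 2023 Thm 8.8 since the fibre varies with `x'`.)

* `exists_expPoint_realHyperplane` — solutions near every large lattice centre;
* `realHyperplane_inter_expGraph_nonempty` — EC vocabulary;
* `sqrt_two_hyperplane_model_system_solvable` — `∃ z w, e^z = z + e^{√2 z - w} ∧ e^w = w² + e^{√2 z - w}`.

HONEST FRAMING: a modest new sub-rung of EAC; nothing here bears on Schanuel's conjecture.
-/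

noncomputable section

open Complex MvPolynomial Metric Set Filter Topology

set_option linter.dupNamespace false

namespace Summit.Schanuel.Schanuel.Theorems

/-- **EC over a real hyperplane base with fibres `yⱼ = Aⱼ(x') + yₙ Fⱼ(yₙ)`.** Let `q ∈ ℤˢ`,
`v = 2πi q`, `r ∈ ℝˢ`, `c ∈ ℂ`, `Aⱼ ∈ ℂ[x₁..xₛ]` with `(Aⱼ)_{dⱼ}(v) ≠ 0`, `Fⱼ ∈ ℂ[u]`, and assume
`λ := Σⱼ rⱼ dⱼ < 0`. Then for all large `m` there is `x ∈ ℂˢ` within `1/2` of the lattice centre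
`x₀(m) = (m vⱼ + log Aⱼ(m v))ⱼ` with
`exp xⱼ = Aⱼ(x) + e^{ℓ(x)} Fⱼ(e^{ℓ(x)})`, `ℓ(x) = Σᵢ rᵢ xᵢ + c` (`j ≤ s`); i.e. the `(s+1)`-fold
`V = {x_{s+1} = Σᵢ rᵢ xᵢ + c, yⱼ = Aⱼ(x') + y_{s+1} Fⱼ(y_{s+1})}` (additive projection a hyperplane,
`dim π₁ V = n - 1`, first open range of Exponential-Algebraic Closedness, Mantova–Masser 2024 §1
p. 5) meets the graph of `exp`. Proof: `Re ℓ(x₀(m) + ξ) = Σⱼ rⱼ (dⱼ log m + O(1)) = λ log m + O(1)`,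
so `|e^{ℓ}| ≤ K m^{λ} → 0` while `Fⱼ(e^{ℓ})` stays bounded; moving-polydisc theorem. New (the
degree-one, polynomial-decay end of the oscillatory class).
[cite: MantovaMasser2023, §1 p.5 (the open case dim π(V) = 2 in ℂ³×ℂˣ³)] -/
theorem exists_expPoint_realHyperplane {s : ℕ} (r : Fin s → ℝ) (c : ℂ) (q : Fin s → ℤ)
    (A : Fin s → MvPolynomial (Fin s) ℂ)
    (hA : ∀ j, eval (fun i => 2 * Real.pi * I * (q i : ℂ))
      (homogeneousComponent (A j).totalDegree (A j)) ≠ 0)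
    (F : Fin s → Polynomial ℂ) (hlam : ∑ j, r j * (A j).totalDegree < 0) :
    ∀ᶠ m : ℕ in atTop, ∃ x : Fin s → ℂ,
      ‖x - fun i => (m : ℂ) * (2 * Real.pi * I * (q i : ℂ)) +
          log (eval (fun k => (m : ℂ) * (2 * Real.pi * I * (q k : ℂ))) (A i))‖ ≤ 1 / 2 ∧
      ∀ j, exp (x j) = eval x (A j) +
        exp (∑ i, (r i : ℂ) * x i + c) * (F j).eval (exp (∑ i, (r i : ℂ) * x i + c)) := by
  classical
  set v : Fin s → ℂ := fun j => 2 * Real.pi * I * (q j : ℂ) with hv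
  set x₀ : ℕ → Fin s → ℂ := fun m i => (m : ℂ) * v i +
    log (eval (fun k => (m : ℂ) * v k) (A i)) with hx₀
  set lam : ℝ := ∑ j, r j * (A j).totalDegree with hlamdef
  -- the perturbation
  set ℓ : (Fin s → ℂ) → ℂ := fun x => ∑ i, (r i : ℂ) * x i + c with hℓ
  set P : Fin s → (Fin s → ℂ) → ℂ := fun j x => exp (ℓ x) * (F j).eval (exp (ℓ x)) with hP
  have hℓdiff : Differentiable ℂ ℓ := by
    refine (Differentiable.fun_sum fun i _ => ?_).add_const _
    exact (differentiable_apply i).const_mul _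
  have hPdiff : ∀ j, Differentiable ℂ (P j) := fun j =>
    hℓdiff.cexp.mul ((F j).differentiable.comp hℓdiff.cexp)
  -- lattice values: two-sided log bounds, eventually
  set a : Fin s → ℝ := fun j => ‖eval v (homogeneousComponent (A j).totalDegree (A j))‖ with ha
  have ha0 : ∀ j, 0 < a j := fun j => norm_pos_iff.mpr (hA j)
  have hctrl := fun j => latticeValue_control (A j) v (hA j) one_pos
  choose ρ hρ t₀ ht₀ hc using hctrl
  -- the constant absorbing the `O(1)` terms
  set C₀ : ℝ := ‖c‖ + ∑ j, |r j| * (|Real.log (a j / 2)| + |Real.log (2 * a j)| + 1) with hC₀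
  have hC₀c : ‖c‖ ≤ C₀ := by
    rw [hC₀]
    have : 0 ≤ ∑ j, |r j| * (|Real.log (a j / 2)| + |Real.log (2 * a j)| + 1) :=
      Finset.sum_nonneg fun j _ => by positivity
    linarith
  -- bound for the fibre polynomials on the disc of radius `exp C₀`
  have hFb : ∀ j, ∃ M : ℝ, 0 ≤ M ∧ ∀ y : ℂ, ‖y‖ ≤ Real.exp C₀ → ‖(F j).eval y‖ ≤ M := by
    intro j
    obtain ⟨M, hM⟩ := (isCompact_closedBall (0 : ℂ) (Real.exp C₀)).exists_bound_of_continuousOn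
      ((F j).continuous).continuousOn
    refine ⟨max M 0, le_max_right _ _, fun y hy => (hM y ?_).trans (le_max_left _ _)⟩
    rwa [mem_closedBall, dist_zero_right]
  choose M hM0 hMb using hFb
  -- ### the key estimate: `Re ℓ ≤ λ log m + C₀` on the unit polydisc around `x₀ m`
  have hkey : ∀ᶠ m : ℕ in atTop, ∀ ξ : Fin s → ℂ, ‖ξ‖ ≤ 1 →
      (ℓ (x₀ m + ξ)).re ≤ lam * Real.log m + C₀ := by
    filter_upwards [eventually_all.2 fun j => tendsto_natCast_atTop_atTop.eventually_ge_atTop (t₀ j)]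
      with m hm ξ hξ
    have hterm : ∀ j, ((r j : ℂ) * (x₀ m j + ξ j)).re ≤
        r j * (A j).totalDegree * Real.log m +
          |r j| * (|Real.log (a j / 2)| + |Real.log (2 * a j)| + 1) := by
      intro j
      obtain ⟨hne, hlow, hupp, -⟩ := hc j m (hm j)
      have hm1 : (1 : ℝ) ≤ m := (ht₀ j).trans (hm j)
      obtain ⟨h1, h2, -⟩ := log_latticeValue_bounds (by have := ha0 j; positivity) hm1 hlow hupp
      have hre : (x₀ m j + ξ j).re = Real.log ‖eval (fun k => (m : ℂ) * v k) (A j)‖ + (ξ j).re := by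
        simp only [hx₀, Complex.add_re, Complex.log_re, Complex.mul_re, Complex.natCast_re,
          Complex.natCast_im, zero_mul, sub_zero]
        have : (v j).re = 0 := by simp [hv]
        rw [this, mul_zero, zero_add]
      rw [Complex.re_ofReal_mul, hre]
      have h3 : |(ξ j).re| ≤ 1 := (Complex.abs_re_le_norm _).trans ((norm_le_pi_norm ξ j).trans hξ)
      rw [abs_le] at h3
      obtain ⟨h3a, h3b⟩ := h3
      -- `t := log ‖α‖ + Re ξ - d log m` lies in `[log(a/2) - 1, log(2a) + 1]`
      set t : ℝ := Real.log ‖eval (fun k => (m : ℂ) * v k) (A j)‖ + (ξ j).re -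
        (A j).totalDegree * Real.log m with ht
      have ht1 : |t| ≤ |Real.log (a j / 2)| + |Real.log (2 * a j)| + 1 := by
        rw [abs_le]
        constructor
        · have := neg_abs_le (Real.log (a j / 2))
          have := abs_nonneg (Real.log (2 * a j))
          rw [ht]; linarith
        · have := le_abs_self (Real.log (2 * a j))
          have := abs_nonneg (Real.log (a j / 2))
          rw [ht]; linarith
      have hsplit : r j * (Real.log ‖eval (fun k => (m : ℂ) * v k) (A j)‖ + (ξ j).re) =
          r j * (A j).totalDegree * Real.log m + r j * t := by rw [ht]; ring
      rw [hsplit]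
      have h4 : r j * t ≤ |r j| * (|Real.log (a j / 2)| + |Real.log (2 * a j)| + 1) := by
        calc r j * t ≤ |r j * t| := le_abs_self _
          _ = |r j| * |t| := abs_mul _ _
          _ ≤ |r j| * (|Real.log (a j / 2)| + |Real.log (2 * a j)| + 1) :=
              mul_le_mul_of_nonneg_left ht1 (abs_nonneg _)
      linarith
    have hℓre : (ℓ (x₀ m + ξ)).re = ∑ i, ((r i : ℂ) * (x₀ m i + ξ i)).re + c.re := by
      simp only [hℓ, Complex.add_re, Complex.re_sum, Pi.add_apply]
    rw [hℓre]
    have hsum := Finset.sum_le_sum fun j (_ : j ∈ Finset.univ) => hterm j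
    rw [Finset.sum_add_distrib, ← Finset.sum_mul] at hsum
    have hc' : c.re ≤ ‖c‖ := Complex.re_le_norm c
    rw [hC₀, hlamdef]
    linarith
  -- ### smallness of the perturbation
  have hPsmall : ∀ j, ∀ θ : ℝ, 0 < θ → ∀ᶠ m : ℕ in atTop, ∀ ξ : Fin s → ℂ, ‖ξ‖ ≤ 1 →
      ‖P j (x₀ m + ξ)‖ ≤ θ := by
    intro j θ hθ
    have hdec : Tendsto (fun m : ℕ => Real.exp C₀ * M j * (m : ℝ) ^ lam) atTop (𝓝 0) := by
      have h := ((tendsto_rpow_neg_atTop (by linarith : 0 < -lam)).comp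
        tendsto_natCast_atTop_atTop).const_mul (Real.exp C₀ * M j)
      rw [mul_zero] at h
      refine h.congr fun m => ?_
      simp only [Function.comp, neg_neg]
    filter_upwards [hkey, hdec.eventually (eventually_le_nhds hθ), eventually_ge_atTop 1]
      with m hm hmθ hm_one ξ hξ
    have hm1' : (1 : ℝ) ≤ m := by exact_mod_cast hm_one
    have hm0 : (0 : ℝ) < m := by linarith
    have hre := hm ξ hξ
    have hexp : ‖exp (ℓ (x₀ m + ξ))‖ ≤ Real.exp C₀ * (m : ℝ) ^ lam := by
      rw [Complex.norm_exp]
      refine (Real.exp_le_exp.mpr hre).trans ?_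
      rw [show lam * Real.log m + C₀ = C₀ + lam * Real.log m by ring, Real.exp_add,
        Real.rpow_def_of_pos hm0, mul_comm (Real.log m)]
    have hexp1 : ‖exp (ℓ (x₀ m + ξ))‖ ≤ Real.exp C₀ := by
      refine hexp.trans ?_
      have : (m : ℝ) ^ lam ≤ 1 := Real.rpow_le_one_of_one_le_of_nonpos hm1' hlam.le
      nlinarith [Real.exp_pos C₀]
    have hF := hMb j _ hexp1
    calc ‖P j (x₀ m + ξ)‖
        = ‖exp (ℓ (x₀ m + ξ))‖ * ‖(F j).eval (exp (ℓ (x₀ m + ξ)))‖ := norm_mul _ _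
      _ ≤ Real.exp C₀ * (m : ℝ) ^ lam * M j := mul_le_mul hexp hF (norm_nonneg _) (by positivity)
      _ = Real.exp C₀ * M j * (m : ℝ) ^ lam := by ring
      _ ≤ θ := hmθ
  exact exists_exp_eq_poly_add_near_latticeCentre q A hA P hPdiff hPsmall

/-- **EC vocabulary**: with `n = s + 1`, under the hypotheses of `exists_expPoint_realHyperplane`
the subvariety `V = {xₙ = Σᵢ rᵢ xᵢ + c, yⱼ = Aⱼ(x') + yₙ Fⱼ(yₙ) (j ≤ s)}` of `ℂⁿ × ℂⁿ`
(distinguished last coordinate `Fin.last s`) contains a point of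
`Literature.NumberTheory.Transcendental.expGraph ℂ n`; its additive projection is the hyperplane
`xₙ = Σ rᵢ xᵢ + c` (real `rᵢ`; additively free iff `r ∉ ℚˢ`, which is not used).
[cite: MantovaMasser2023, §1 p.5 (the open case dim π(V) = 2 in ℂ³×ℂˣ³)] -/
theorem realHyperplane_inter_expGraph_nonempty {s : ℕ} (r : Fin s → ℝ) (c : ℂ) (q : Fin s → ℤ)
    (A : Fin s → MvPolynomial (Fin s) ℂ)
    (hA : ∀ j, eval (fun i => 2 * Real.pi * I * (q i : ℂ))
      (homogeneousComponent (A j).totalDegree (A j)) ≠ 0)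
    (F : Fin s → Polynomial ℂ) (hlam : ∑ j, r j * (A j).totalDegree < 0) :
    ({z : Fin (s + 1) ⊕ Fin (s + 1) → ℂ |
        z (Sum.inl (Fin.last s)) = ∑ i, (r i : ℂ) * z (Sum.inl (Fin.castSucc i)) + c ∧
        ∀ j : Fin s, z (Sum.inr (Fin.castSucc j)) =
          eval (fun i => z (Sum.inl (Fin.castSucc i))) (A j) +
            z (Sum.inr (Fin.last s)) * (F j).eval (z (Sum.inr (Fin.last s)))} ∩
      Literature.NumberTheory.Transcendental.expGraph ℂ (s + 1)).Nonempty := by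
  obtain ⟨m, x, -, hx⟩ := (exists_expPoint_realHyperplane r c q A hA F hlam).exists
  set X : Fin (s + 1) → ℂ := Fin.snoc x (∑ i, (r i : ℂ) * x i + c) with hX
  refine ⟨Sum.elim X fun i => exp (X i), ⟨?_, fun j => ?_⟩, fun i => ?_⟩
  · simp only [Sum.elim_inl, hX, Fin.snoc_last, Fin.snoc_castSucc]
  · simp only [Sum.elim_inl, Sum.elim_inr, hX, Fin.snoc_castSucc, Fin.snoc_last]
    exact hx j
  · simp [Literature.ModelTheory.ExponentialFields.ExponentialRing.complex_exp_eq]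

/-- **A real-hyperplane model system is solvable**: there are `z, w ∈ ℂ` with
`e^z = z + e^{√2 z - w}` and `e^w = w² + e^{√2 z - w}` — an exponential point of the 3-fold
`V = {x₃ = √2 x₁ - x₂, y₁ = x₁ + y₃, y₂ = x₂² + y₃}`, base the real non-rational plane
`x₃ = √2 x₁ - x₂` (additively free), `λ = √2·1 - 1·2 < 0`; `q = (1,1)`. New.
[cite: MantovaMasser2023, §1 p.5 (the open case dim π(V) = 2 in ℂ³×ℂˣ³)] -/
theorem sqrt_two_hyperplane_model_system_solvable :
    ∃ z w : ℂ, exp z = z + exp (Real.sqrt 2 * z - w) ∧ exp w = w ^ 2 + exp (Real.sqrt 2 * z - w) := by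
  set q : Fin 2 → ℤ := ![1, 1] with hq
  have hv : (fun j : Fin 2 => 2 * (Real.pi : ℂ) * I * ((q j : ℤ) : ℂ)) = fun _ => 2 * Real.pi * I := by
    funext j; fin_cases j <;> simp [hq]
  set A : Fin 2 → MvPolynomial (Fin 2) ℂ := ![X 0, X 1 ^ 2] with hAdef
  have hA0 : A 0 = X 0 := by simp [hAdef]
  have hA1 : A 1 = X 1 ^ 2 := by simp [hAdef]
  have hdegA0 : (A 0).totalDegree = 1 := by rw [hA0, totalDegree_X]
  have hdegA1 : (A 1).totalDegree = 2 := by rw [hA1, totalDegree_X_pow]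
  have hpi : (2 * (Real.pi : ℂ) * I) ≠ 0 := by
    have := Real.pi_pos
    simp [Complex.ext_iff, this.ne']
  have hA : ∀ j, eval (fun i : Fin 2 => 2 * Real.pi * I * ((q i : ℤ) : ℂ))
      (homogeneousComponent (A j).totalDegree (A j)) ≠ 0 := by
    rw [hv]
    refine Fin.forall_fin_two.mpr ⟨?_, ?_⟩
    · rw [hdegA0, hA0, homogeneousComponent_eq_self (isHomogeneous_X ℂ 0), eval_X]; exact hpi
    · rw [hdegA1, hA1, homogeneousComponent_eq_self (isHomogeneous_X_pow 1 2), map_pow, eval_X]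
      exact pow_ne_zero _ hpi
  set r : Fin 2 → ℝ := ![Real.sqrt 2, -1] with hr
  have hlam : ∑ j, r j * (A j).totalDegree < 0 := by
    rw [Fin.sum_univ_two, hdegA0, hdegA1]
    simp only [hr, Matrix.cons_val_zero, Matrix.cons_val_one, Matrix.cons_val_fin_one]
    have h2 : Real.sqrt 2 < 2 := by
      rw [show (2 : ℝ) = Real.sqrt 4 by rw [show (4:ℝ) = 2 ^ 2 by norm_num, Real.sqrt_sq (by norm_num)]]
      exact Real.sqrt_lt_sqrt (by norm_num) (by norm_num)
    push_cast
    linarith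
  obtain ⟨m, x, -, hx⟩ := (exists_expPoint_realHyperplane r 0 q A hA
    (fun _ => Polynomial.C 1) hlam).exists
  have hℓ : ∑ i, ((r i : ℝ) : ℂ) * x i + 0 = Real.sqrt 2 * x 0 - x 1 := by
    rw [Fin.sum_univ_two]
    simp only [hr, Matrix.cons_val_zero, Matrix.cons_val_one, Matrix.cons_val_fin_one]
    push_cast
    ring
  refine ⟨x 0, x 1, ?_, ?_⟩
  · have h := hx 0
    rw [hA0, eval_X, hℓ, Polynomial.eval_C, mul_one] at h
    exact h
  · have h := hx 1
    rw [hA1, map_pow, eval_X, hℓ, Polynomial.eval_C, mul_one] at h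
    exact h

end Summit.Schanuel.Schanuel.Theorems
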